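/-
Copyright (c) 2026 the pub-hodgecm-mathlib formalisation cell (harness21).  Prover seat hodgecm-mathlib-LH4-p01 (g6); (C5)′ «LARGE» (dealer LH4-plan (g7) WORD #39,
census `F0/P3c/LH4/LH4-p01/g6/large/CENSUS-Large.v1.md`), 2026-09-02.  Sequel of `UnitOrbitalIntegralInertCountJZeroLargeTrace` (400-line rule): the dispatch.
-/
import Literature.NumberTheory.Rogawski1990.UnitOrbitalIntegralInertCountJZeroLargeTrace     -- LH4-p01: §1–§2 (the regimes as coset counts, trace frame)
import Literature.NumberTheory.Rogawski1990.UnitOrbitalIntegralInertCountJZeroLarge          -- ★ F0P3a-p04: `cast_count_bd_eq`, `iThirteen`, `natCast_count_c_eq` (CITE)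
import HarnessLib

/-!
# Flicker's PROPOSITION 13 for `m > N` in the TRACE frame — the dispatch `(#cosets : ℚ) = iThirteen q N N₊ M m`

Topic `NumberTheory/Rogawski1990` (road «D-N7-inert», LAYER C block (C5)′); namespace `Literature.NumberTheory.Automorphic.UnitaryGroup`.  Twin of ★
`UnitOrbitalIntegralInertCountJZeroLarge` §3 (F0P3a-p04 (g12)): the `rcases hreg` tree and the `iThirteen` `if`-ladder VERBATIM, over the trace-frame regime counts of
`UnitOrbitalIntegralInertCountJZeroLargeTrace` ((R-kill) `natCard_cosets_jzero_eq_zero_of_v_lt_of_rel`, (R-far) `…_of_far_of_rel`, (R-ce odd) `…_of_odd_of_rel`, (R-bd)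
`natCard_cosets_jzero_bd_of_rel`, the case-(e) pointwise criterion `conj_mem_flickerHK_iff_norm_sub_le_of_rel`).  Letters: the `j = 0` relations of ★ FILE 1
`UnitaryThreeBorelConjugateCongruencesJZeroTrace`; exponent dictionary `|B₂| = |ϖ^N|`, `|G − σG| = |ϖ^M|`, `|r(s+r)| = |ϖ^{M−N}|`, type A `|D − b| = |ϖ^{N₊}|`; the
case-(e) norm-residue count `(q+1)²q^{2m+N−2}` (precision `2m − N > m`, beyond `ρ_m`) is the binder `hce` in the `X`-shape, values-abstract exactly as ★'s.  CONCLUSION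
`(Nat.card {…} : ℚ) = iThirteen q N Np M m` VERBATIM.  THEOREMS ONLY: no definition, no named fact, no instance, no notation, no `sorry`; kernel lane.
FINDING #19 status: the half `m > N` is residue-characteristic-clean in every cell (census (6), dealer WORD #44 (c1) ledger «LARGE ∕ BOX: none»); the file asserts the
(R-bd) box value (LINEAR conditions) and keeps case (e) values-abstract.  HONEST LABEL: HC_CM is proved only modulo the printed citations (hLiu418, h413) until rung 0
closes; this file is a finite count and proves no letter (count-neutral, (D-UNR) PRINT).

## References
* [Flicker1998UnitaryFL] Y. Z. Flicker, *Elementary proof of the fundamental lemma for a unitary group*, Canad. J. Math. 50 (1998): Prop. 13 pp. 91–93, Prop. 8 p. 84.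
* [Rogawski1990] J. D. Rogawski, *Automorphic Representations of Unitary Groups in Three Variables* (1990), §4.9 p. 55.
-/

set_option autoImplicit false

open scoped MatrixGroups WithZero Valued
open Matrix

namespace Literature.NumberTheory.Automorphic

namespace UnitaryGroup

open Literature.NumberTheory.Automorphic.HermitianLattice (unitaryInt mem_unitaryInt_iff UnramifiedLocalConjDatum)
open Literature.NumberTheory.Rogawski1990.Flicker1998 (iThirteen natCast_count_c_eq)
open IsLocalRing

variable {K : Type*} [Field K] [Valued K ℤᵐ⁰] {ϖ : K} (σ : K →+* K) {J : Matrix (Fin 3) (Fin 3) K}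

section Count

variable [IsDiscreteValuationRing 𝒪[K]] [Finite (ResidueField 𝒪[K])] [IsAdicComplete (maximalIdeal 𝒪[K]) 𝒪[K]]

/-- **FLICKER'S PROPOSITION 13, the half `N < m`, TRACE FRAME** (`j = 0`, every residue characteristic): for the torus corner `τ = !![A,0,B₁; 0,b,0; B₂,0,D] ∈ H` with the
`j = 0` letters of ★ FILE 1 (`B₁ = κσκB₂`, `A − D = (σκ − κ)B₂`, `B₂G = (D − b − κB₂)s`, `r(κ + σκ) = b₀G + σb₀σG`, `z + r = κw₀ + y₀`), `|B₂| = |ϖ^N|` and the exponent data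
`hreg` (`N₊ < N`, or `N ≤ N₊ ∧ N ≤ M ∧ |r(s+r)| = |ϖ^{M−N}| ∧ |G − σG| = |ϖ^M|`) [+ `N₊ < N → |D − b| = |ϖ^{N₊}|`], the number of cosets `y ∈ P_H ⧸ (P_H ∩ H^K_m)`
with `y⁻¹ τ y ∈ H^K_m` is the printed table ★ `iThirteen q N N₊ M m` — given Prop. 8's fibre size `q^m` (`hfib`), `S ≤ N₀` (`hSN`), and the binder `hce` = the case-(e)
norm-residue count `(q+1)² q^{2m+N−2}` under its pointwise `X`-criterion (precision `2m − N > m`, values-abstract as ★'s).  Twin of ★ `natCard_cosets_jzero_eq_iThirteen_of_lt`.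
[cite: Flicker1998UnitaryFL, Prop. 13 (d)(e) pp. 91–92] -/
theorem natCard_cosets_jzero_eq_iThirteen_of_lt_of_rel (hJ : J = (StdForm.antidiagonal 3).over K) (hd : UnramifiedLocalConjDatum σ ϖ) (h2 : (2 : K) ≠ 0)
    (hσO : ∀ y : 𝒪[K], (σ.comp 𝒪[K].subtype) y ∈ 𝒪[K]) {y z : K} (hy : Valued.v y = 1) (hzv : Valued.v z ≤ 1) (hz : z + σ z + y * σ y = 0)
    {m N Np M : ℕ} (hNm : N < m)
    {c um τ : ↥(unitaryGroupOfForm σ J)} (hc : ((c : GL (Fin 3) K) : Matrix (Fin 3) (Fin 3) K) = !![1, 0, 0; 0, -1, 0; 0, 0, 1])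
    (hum : ((um : GL (Fin 3) K) : Matrix (Fin 3) (Fin 3) K) = !![ϖ ^ m, y, z * (ϖ ^ m)⁻¹; 0, 1, -σ y * (ϖ ^ m)⁻¹; 0, 0, (ϖ ^ m)⁻¹])
    {A B₁ B₂ D b κ b₀ G r s w₀ y₀ : K} (hs : s = -(y * σ y)) (hκ : Valued.v κ ≤ 1) (htr : Valued.v (κ + σ κ) = 1) (hrv : Valued.v r ≤ 1)
    (hb₀ : b₀ + σ b₀ = 1) (hb₀v : Valued.v b₀ ≤ 1)
    (hB₁ : B₁ = κ * σ κ * B₂) (hAD : A - D = (σ κ - κ) * B₂) (hG : B₂ * G = (D - b - κ * B₂) * s) (hr : r * (κ + σ κ) = b₀ * G + σ b₀ * σ G)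
    (hc0 : z + r = κ * w₀ + y₀) (hσw₀ : σ w₀ = w₀) (hσy₀ : σ y₀ = -y₀)
    (hτ : ((τ : GL (Fin 3) K) : Matrix (Fin 3) (Fin 3) K) = !![A, 0, B₁; 0, b, 0; B₂, 0, D])
    (hτH : τ ∈ Subgroup.centralizer ({c} : Set ↥(unitaryGroupOfForm σ J)))
    (hB : Valued.v B₂ = Valued.v (ϖ ^ N)) (hsδ : Np < N → Valued.v (D - b) = Valued.v (ϖ ^ Np))
    (hreg : Np < N ∨ (N ≤ Np ∧ N ≤ M ∧ Valued.v (r * (s + r)) = Valued.v (ϖ ^ (M - N)) ∧ Valued.v (G - σ G) = Valued.v (ϖ ^ M)))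
    {q : ℕ} (hq : Nat.card (ResidueField 𝒪[K]) = q ^ 2)
    {a₀ : 𝒪[K]} (ha₀ : IsUnit (((σ.comp 𝒪[K].subtype).codRestrict 𝒪[K] hσO) a₀ - a₀))
    (hSN : flickerPH σ J c ⊓ flickerHK σ J c um ≤ flickerPH0 σ J c (ϖ ^ m))
    [Finite (↥(flickerPH σ J c) ⧸ (flickerHK σ J c um).subgroupOf (flickerPH σ J c))]
    (hfib : ∀ z ∈ Set.range (fun w : ↥(flickerPH σ J c) ⧸ (flickerHK σ J c um).subgroupOf (flickerPH σ J c) =>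
        flickerPHRho σ m ((Quotient.out w : ↥(flickerPH σ J c)) : ↥(unitaryGroupOfForm σ J))),
      Nat.card {w : ↥(flickerPH σ J c) ⧸ (flickerHK σ J c um).subgroupOf (flickerPH σ J c) //
        flickerPHRho σ m ((Quotient.out w : ↥(flickerPH σ J c)) : ↥(unitaryGroupOfForm σ J)) = z} = q ^ m)
    (hce : N ≤ Np → M < 2 * m → 2 * m ≤ M + N → (M - N) % 2 = 0 →
      (∀ p ∈ flickerPH σ J c, ∀ u x w : K,
        ((p : GL (Fin 3) K) : Matrix (Fin 3) (Fin 3) K) = !![u, 0, u * x; 0, w, 0; 0, 0, (σ u)⁻¹] →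
          (p⁻¹ * τ * p ∈ flickerHK σ J c um ↔
            Valued.v ((κ * (u * σ u)⁻¹ + (x + z) + r) * σ (κ * (u * σ u)⁻¹ + (x + z) + r) - r * (s + r)) ≤ Valued.v (ϖ ^ (2 * m - N)))) →
      Nat.card {w : ↥(flickerPH σ J c) ⧸ (flickerHK σ J c um).subgroupOf (flickerPH σ J c) //
        ((Quotient.out w : ↥(flickerPH σ J c)) : ↥(unitaryGroupOfForm σ J))⁻¹ * τ * (Quotient.out w : ↥(flickerPH σ J c)) ∈ flickerHK σ J c um} =
        (q + 1) ^ 2 * q ^ (2 * m + N - 2)) :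
    (Nat.card {w : ↥(flickerPH σ J c) ⧸ (flickerHK σ J c um).subgroupOf (flickerPH σ J c) //
      ((Quotient.out w : ↥(flickerPH σ J c)) : ↥(unitaryGroupOfForm σ J))⁻¹ * τ * (Quotient.out w : ↥(flickerPH σ J c)) ∈ flickerHK σ J c um} : ℚ) =
      iThirteen q N Np M m := by
  have hq0 : q ≠ 0 := by
    rintro rfl
    have h1 : 0 < Nat.card (ResidueField 𝒪[K]) := Nat.card_pos
    rw [hq] at h1; simp at h1
  have hq1 : 1 ≤ q := Nat.pos_of_ne_zero hq0
  have hB0 : B₂ ≠ 0 := fun h => by rw [h, map_zero] at hB; exact (pow_ne_zero N hd.ϖ_ne_zero) ((Valuation.zero_iff _).1 hB.symm)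
  have hvmm : Valued.v (ϖ ^ m) * Valued.v (ϖ ^ m) = Valued.v (ϖ ^ (2 * m)) := by rw [← map_mul, ← pow_add, two_mul]
  have vle : ∀ {a b : ℕ}, Valued.v (ϖ ^ a) ≤ Valued.v (ϖ ^ b) ↔ b ≤ a := fun {a b} => by rw [hd.v_pow, hd.v_pow, WithZero.exp_le_exp]; omega
  have vlt : ∀ {a b : ℕ}, Valued.v (ϖ ^ a) < Valued.v (ϖ ^ b) ↔ b < a := fun {a b} => by rw [hd.v_pow, hd.v_pow, WithZero.exp_lt_exp]; omega
  have hm : 1 ≤ m := by omega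
  have hm0 : m ≠ 0 := by omega
  have htr0 : κ + σ κ ≠ 0 := fun h => by rw [h, map_zero] at htr; exact zero_ne_one htr
  -- `B₁ = B₂·p` with `|p| ≤ 1`, and `|A − D| ≤ |B₂|`
  have hB₁' : B₁ = B₂ * (κ * σ κ) := by rw [hB₁]; ring
  have hp1 : Valued.v (κ * σ κ) ≤ 1 := by rw [map_mul, hd.vσ]; exact mul_le_one' hκ hκ
  have hADle : Valued.v (A - D) ≤ Valued.v B₂ := by
    rw [hAD, map_mul]
    exact le_trans (mul_le_mul' (le_trans (Valuation.map_sub _ _ _) (max_le (by rw [hd.vσ]; exact hκ) hκ)) le_rfl) (by rw [one_mul])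
  rcases hreg with hlt | ⟨hge, hNM, hCv, hGv⟩
  · -- N₊ < N < m : (R-kill)
    have hDb : Valued.v (D - b) = Valued.v (ϖ ^ Np) := hsδ hlt
    rw [natCard_cosets_jzero_eq_zero_of_v_lt_of_rel σ hJ hd h2 hy hzv hz m hc hum hB₁' hp1 hτ hτH
        (lt_of_le_of_lt hADle (by rw [hB, hDb, vlt]; exact hlt)) (by rw [hB, hDb, vlt]; exact hlt) (by rw [hvmm, hDb, vlt]; omega),
      iThirteen, if_neg hm0, if_neg (by omega), if_neg (by omega), if_neg (by omega), if_neg (by omega), if_neg (by omega), Nat.cast_zero]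
  · -- N = N₊ < m
    by_cases hfar2 : M + N < 2 * m
    · -- (R-far)
      rw [natCard_cosets_jzero_eq_zero_of_far_of_rel σ hJ hd h2 hy hz m hc hum hs htr0 hb₀ hB₁ hAD hG hr hB0 hτ hτH
          (by rw [hvmm, hB, hGv, ← map_mul, ← pow_add, vlt]; omega),
        iThirteen, if_neg hm0, if_neg (by omega), if_neg (by omega), if_neg (by omega), if_neg (by omega), if_neg (by omega), Nat.cast_zero]
    have hg2 : Valued.v (G - σ G) ≤ Valued.v (ϖ ^ (2 * m - N)) := by rw [hGv, vle]; omega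
    by_cases hbd : 2 * m ≤ M
    · -- (R-bd) : case (d)
      have hcnt := natCard_cosets_jzero_bd_of_rel σ hJ hd h2 hσO hy hzv hz hm hNm.le hc hum hs hκ htr hrv hb₀ hb₀v hB₁ hAD hG hr hB hc0 hσw₀ hσy₀
        hτ hτH (by rw [hCv, vle]; omega) hg2 hq ha₀ hSN hfib
      rw [hcnt, cast_count_bd_eq hq1 hm (by omega), iThirteen, if_neg hm0, if_neg (by omega), if_neg (by omega), if_neg (by omega),
        if_pos ⟨hge, by omega, by omega⟩]
    · -- (R-ce) : case (e), `M < 2m ≤ M + N`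
      have hnear : Valued.v (ϖ ^ (2 * m - N)) < Valued.v (r * (s + r)) := by rw [hCv, vlt]; omega
      by_cases hpar : (M - N) % 2 = 0
      · have hcnt := hce hge (by omega) (by omega) hpar (fun p hp u x w hpm =>
          conj_mem_flickerHK_iff_norm_sub_le_of_rel σ hJ hd h2 hy hz hNm.le (by omega) (by omega) hc hum hs htr0 hrv hb₀ hb₀v
            hB₁ hAD hG hr hB hCv hGv hnear hτ hτH hp hpm)
        rw [hcnt, natCast_count_c_eq hq1 (k := 2 * m + N) (by omega), iThirteen, if_neg hm0, if_neg (by omega), if_neg (by omega),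
          if_neg (by omega), if_neg (by omega), if_pos ⟨hge, by omega, by omega, hpar⟩]
      · -- odd: no solution
        have hodd : ¬ ∃ e : ℤ, Valued.v (r * (s + r)) = WithZero.exp (2 * e) := by
          rintro ⟨e, he⟩
          rw [hCv, hd.v_pow, WithZero.exp_inj] at he
          omega
        rw [natCard_cosets_jzero_eq_zero_of_odd_of_rel σ hJ hd h2 hy hz (by omega) hc hum hs htr0 hb₀ hb₀v hB₁ hAD hG hr hB hτ hτH hg2 hnear hodd,
          iThirteen, if_neg hm0, if_neg (by omega), if_neg (by omega), if_neg (by omega), if_neg (by omega),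
          if_neg (by rintro ⟨-, -, -, h⟩; exact hpar h), Nat.cast_zero]

/-- **PROP. 13, `N < m`, TRACE FRAME — ED. 2 (`N = 0` admitted)**: as `natCard_cosets_jzero_eq_iThirteen_of_lt_of_rel`, the type-B datum WEAKENED to `|r(s+r)| ≤ |ϖ^{M−N}|`,
with `=` only for `1 ≤ N` (used solely when `M < 2m ≤ M + N`, empty at `N = 0`).  Twin of ★ `natCard_cosets_jzero_eq_iThirteen_of_lt'`.
[cite: Flicker1998UnitaryFL, Prop. 13 (d)(e) pp. 91–92] -/
theorem natCard_cosets_jzero_eq_iThirteen_of_lt_of_rel' (hJ : J = (StdForm.antidiagonal 3).over K) (hd : UnramifiedLocalConjDatum σ ϖ) (h2 : (2 : K) ≠ 0)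
    (hσO : ∀ y : 𝒪[K], (σ.comp 𝒪[K].subtype) y ∈ 𝒪[K]) {y z : K} (hy : Valued.v y = 1) (hzv : Valued.v z ≤ 1) (hz : z + σ z + y * σ y = 0)
    {m N Np M : ℕ} (hNm : N < m)
    {c um τ : ↥(unitaryGroupOfForm σ J)} (hc : ((c : GL (Fin 3) K) : Matrix (Fin 3) (Fin 3) K) = !![1, 0, 0; 0, -1, 0; 0, 0, 1])
    (hum : ((um : GL (Fin 3) K) : Matrix (Fin 3) (Fin 3) K) = !![ϖ ^ m, y, z * (ϖ ^ m)⁻¹; 0, 1, -σ y * (ϖ ^ m)⁻¹; 0, 0, (ϖ ^ m)⁻¹])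
    {A B₁ B₂ D b κ b₀ G r s w₀ y₀ : K} (hs : s = -(y * σ y)) (hκ : Valued.v κ ≤ 1) (htr : Valued.v (κ + σ κ) = 1) (hrv : Valued.v r ≤ 1)
    (hb₀ : b₀ + σ b₀ = 1) (hb₀v : Valued.v b₀ ≤ 1)
    (hB₁ : B₁ = κ * σ κ * B₂) (hAD : A - D = (σ κ - κ) * B₂) (hG : B₂ * G = (D - b - κ * B₂) * s) (hr : r * (κ + σ κ) = b₀ * G + σ b₀ * σ G)
    (hc0 : z + r = κ * w₀ + y₀) (hσw₀ : σ w₀ = w₀) (hσy₀ : σ y₀ = -y₀)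
    (hτ : ((τ : GL (Fin 3) K) : Matrix (Fin 3) (Fin 3) K) = !![A, 0, B₁; 0, b, 0; B₂, 0, D])
    (hτH : τ ∈ Subgroup.centralizer ({c} : Set ↥(unitaryGroupOfForm σ J)))
    (hB : Valued.v B₂ = Valued.v (ϖ ^ N)) (hsδ : Np < N → Valued.v (D - b) = Valued.v (ϖ ^ Np))
    (hreg : Np < N ∨ (N ≤ Np ∧ N ≤ M ∧ Valued.v (r * (s + r)) ≤ Valued.v (ϖ ^ (M - N)) ∧
      (1 ≤ N → Valued.v (r * (s + r)) = Valued.v (ϖ ^ (M - N))) ∧ Valued.v (G - σ G) = Valued.v (ϖ ^ M)))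
    {q : ℕ} (hq : Nat.card (ResidueField 𝒪[K]) = q ^ 2)
    {a₀ : 𝒪[K]} (ha₀ : IsUnit (((σ.comp 𝒪[K].subtype).codRestrict 𝒪[K] hσO) a₀ - a₀))
    (hSN : flickerPH σ J c ⊓ flickerHK σ J c um ≤ flickerPH0 σ J c (ϖ ^ m))
    [Finite (↥(flickerPH σ J c) ⧸ (flickerHK σ J c um).subgroupOf (flickerPH σ J c))]
    (hfib : ∀ z ∈ Set.range (fun w : ↥(flickerPH σ J c) ⧸ (flickerHK σ J c um).subgroupOf (flickerPH σ J c) =>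
        flickerPHRho σ m ((Quotient.out w : ↥(flickerPH σ J c)) : ↥(unitaryGroupOfForm σ J))),
      Nat.card {w : ↥(flickerPH σ J c) ⧸ (flickerHK σ J c um).subgroupOf (flickerPH σ J c) //
        flickerPHRho σ m ((Quotient.out w : ↥(flickerPH σ J c)) : ↥(unitaryGroupOfForm σ J)) = z} = q ^ m)
    (hce : N ≤ Np → M < 2 * m → 2 * m ≤ M + N → (M - N) % 2 = 0 →
      (∀ p ∈ flickerPH σ J c, ∀ u x w : K,
        ((p : GL (Fin 3) K) : Matrix (Fin 3) (Fin 3) K) = !![u, 0, u * x; 0, w, 0; 0, 0, (σ u)⁻¹] →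
          (p⁻¹ * τ * p ∈ flickerHK σ J c um ↔
            Valued.v ((κ * (u * σ u)⁻¹ + (x + z) + r) * σ (κ * (u * σ u)⁻¹ + (x + z) + r) - r * (s + r)) ≤ Valued.v (ϖ ^ (2 * m - N)))) →
      Nat.card {w : ↥(flickerPH σ J c) ⧸ (flickerHK σ J c um).subgroupOf (flickerPH σ J c) //
        ((Quotient.out w : ↥(flickerPH σ J c)) : ↥(unitaryGroupOfForm σ J))⁻¹ * τ * (Quotient.out w : ↥(flickerPH σ J c)) ∈ flickerHK σ J c um} =
        (q + 1) ^ 2 * q ^ (2 * m + N - 2)) :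
    (Nat.card {w : ↥(flickerPH σ J c) ⧸ (flickerHK σ J c um).subgroupOf (flickerPH σ J c) //
      ((Quotient.out w : ↥(flickerPH σ J c)) : ↥(unitaryGroupOfForm σ J))⁻¹ * τ * (Quotient.out w : ↥(flickerPH σ J c)) ∈ flickerHK σ J c um} : ℚ) =
      iThirteen q N Np M m := by
  have hq0 : q ≠ 0 := by rintro rfl; have h1 : 0 < Nat.card (ResidueField 𝒪[K]) := Nat.card_pos; rw [hq] at h1; simp at h1
  have hq1 : 1 ≤ q := Nat.pos_of_ne_zero hq0
  have hB0 : B₂ ≠ 0 := fun h => by rw [h, map_zero] at hB; exact (pow_ne_zero N hd.ϖ_ne_zero) ((Valuation.zero_iff _).1 hB.symm)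
  have hvmm : Valued.v (ϖ ^ m) * Valued.v (ϖ ^ m) = Valued.v (ϖ ^ (2 * m)) := by rw [← map_mul, ← pow_add, two_mul]
  have vle : ∀ {a b : ℕ}, Valued.v (ϖ ^ a) ≤ Valued.v (ϖ ^ b) ↔ b ≤ a := fun {a b} => by rw [hd.v_pow, hd.v_pow, WithZero.exp_le_exp]; omega
  have vlt : ∀ {a b : ℕ}, Valued.v (ϖ ^ a) < Valued.v (ϖ ^ b) ↔ b < a := fun {a b} => by rw [hd.v_pow, hd.v_pow, WithZero.exp_lt_exp]; omega
  obtain ⟨hm, hm0⟩ : 1 ≤ m ∧ m ≠ 0 := ⟨by omega, by omega⟩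
  have htr0 : κ + σ κ ≠ 0 := fun h => by rw [h, map_zero] at htr; exact zero_ne_one htr
  have hB₁' : B₁ = B₂ * (κ * σ κ) := by rw [hB₁]; ring
  have hp1 : Valued.v (κ * σ κ) ≤ 1 := by rw [map_mul, hd.vσ]; exact mul_le_one' hκ hκ
  have hADle : Valued.v (A - D) ≤ Valued.v B₂ := by
    rw [hAD, map_mul]
    exact le_trans (mul_le_mul' (le_trans (Valuation.map_sub _ _ _) (max_le (by rw [hd.vσ]; exact hκ) hκ)) le_rfl) (by rw [one_mul])
  rcases hreg with hlt | ⟨hge, hNM, hc₁le, hc₁eq, hGv⟩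
  · -- N₊ < N < m : (R-kill)
    have hDb : Valued.v (D - b) = Valued.v (ϖ ^ Np) := hsδ hlt
    rw [natCard_cosets_jzero_eq_zero_of_v_lt_of_rel σ hJ hd h2 hy hzv hz m hc hum hB₁' hp1 hτ hτH
        (lt_of_le_of_lt hADle (by rw [hB, hDb, vlt]; exact hlt)) (by rw [hB, hDb, vlt]; exact hlt) (by rw [hvmm, hDb, vlt]; omega),
      iThirteen, if_neg hm0, if_neg (by omega), if_neg (by omega), if_neg (by omega), if_neg (by omega), if_neg (by omega), Nat.cast_zero]
  · -- N = N₊ < m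
    by_cases hfar2 : M + N < 2 * m
    · -- (R-far)
      rw [natCard_cosets_jzero_eq_zero_of_far_of_rel σ hJ hd h2 hy hz m hc hum hs htr0 hb₀ hB₁ hAD hG hr hB0 hτ hτH
          (by rw [hvmm, hB, hGv, ← map_mul, ← pow_add, vlt]; omega),
        iThirteen, if_neg hm0, if_neg (by omega), if_neg (by omega), if_neg (by omega), if_neg (by omega), if_neg (by omega), Nat.cast_zero]
    have hg2 : Valued.v (G - σ G) ≤ Valued.v (ϖ ^ (2 * m - N)) := by rw [hGv, vle]; omega
    by_cases hbd : 2 * m ≤ M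
    · -- (R-bd) : case (d)
      have hcnt := natCard_cosets_jzero_bd_of_rel σ hJ hd h2 hσO hy hzv hz hm hNm.le hc hum hs hκ htr hrv hb₀ hb₀v hB₁ hAD hG hr hB hc0 hσw₀ hσy₀
        hτ hτH (le_trans hc₁le (by rw [vle]; omega)) hg2 hq ha₀ hSN hfib
      rw [hcnt, cast_count_bd_eq hq1 hm (by omega), iThirteen, if_neg hm0, if_neg (by omega), if_neg (by omega), if_neg (by omega),
        if_pos ⟨hge, by omega, by omega⟩]
    · -- (R-ce) : case (e), `M < 2m ≤ M + N`
      have hCv := hc₁eq (by omega)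
      have hnear : Valued.v (ϖ ^ (2 * m - N)) < Valued.v (r * (s + r)) := by rw [hCv, vlt]; omega
      by_cases hpar : (M - N) % 2 = 0
      · have hcnt := hce hge (by omega) (by omega) hpar (fun p hp u x w hpm =>
          conj_mem_flickerHK_iff_norm_sub_le_of_rel σ hJ hd h2 hy hz hNm.le (by omega) (by omega) hc hum hs htr0 hrv hb₀ hb₀v
            hB₁ hAD hG hr hB hCv hGv hnear hτ hτH hp hpm)
        rw [hcnt, natCast_count_c_eq hq1 (k := 2 * m + N) (by omega), iThirteen, if_neg hm0, if_neg (by omega), if_neg (by omega),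
          if_neg (by omega), if_neg (by omega), if_pos ⟨hge, by omega, by omega, hpar⟩]
      · -- odd: no solution
        have hodd : ¬ ∃ e : ℤ, Valued.v (r * (s + r)) = WithZero.exp (2 * e) := by
          rintro ⟨e, he⟩; rw [hCv, hd.v_pow, WithZero.exp_inj] at he; omega
        rw [natCard_cosets_jzero_eq_zero_of_odd_of_rel σ hJ hd h2 hy hz (by omega) hc hum hs htr0 hb₀ hb₀v hB₁ hAD hG hr hB hτ hτH hg2 hnear hodd,
          iThirteen, if_neg hm0, if_neg (by omega), if_neg (by omega), if_neg (by omega), if_neg (by omega),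
          if_neg (by rintro ⟨-, -, -, h⟩; exact hpar h), Nat.cast_zero]

end Count

end UnitaryGroup

end Literature.NumberTheory.Automorphic
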